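import Summits.BirchSwinnertonDyer.BirchSwinnertonDyer.Theorems.AlignedTransportAtTwoMainConjectureOfRankZeroBSDAtTwoCubicLayerOneDoors
import Literature.NumberTheory.IwasawaTheory.NarrowClassGroupPRankStableOfRankJumpLt
import Literature.NumberTheory.IwasawaTheory.CyclotomicTwoTotallyRamifiedOddIndex
import HarnessLib

/-!
# Route `AlignedTransportAtTwo`, crux C2 `MainConjectureOfRankZeroBSDAtTwo` (stmt-BirchSwinnertonDyer-22298):
# THE NARROW JUMP DOOR into `MC₂(W)` — BOTH SIGNS of `Δ_W`: ONE inequality of narrow `2`-ranks between the layers `n₀ + 1` and `n₀ + 2` of the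
# cyclotomic `ℤ₂`-tower of the cubic field `ℚ(β)` delivers the narrow `μ₂⁺`-data (Kida-lite inputs) and hence `MC₂(W)` (modulo PRINT⁵ + MuIneqʳ)

HONEST FRAMING (cell `bsd-f1-sign2`, WIDTH-5 attached prover seat `bsd-line-att-p3` gen 40 on line `birth` of the lead `bsd-line-att-p2`;
`--supports` stmt-BirchSwinnertonDyer-22298, closes nothing; BSD is NOT proved by any of this; the crux C2, its verdict «blocked-on
`Rank1Residual.GreenbergMuConjectureIrreducible`» and every registered stub are untouched). THEOREMS ONLY — no definition, no named fact, no `sorry`;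
every arithmetic input is a DISPLAYED hypothesis; every door is CONDITIONAL on PRINT⁵ (`h17`, `hGr`, `hper`, `hmod`, `hGZK`) and on MuIneqʳ VERBATIM (`hI`).

WHY. On `0 < Δ_W` the cubic `2`-torsion field `ℚ(β)` is totally real and the cell's C2-input is NARROW: att-p5 g24's both-signs door
`…CubicCarrierRoad.mazurMainConjecture_two_of_muIneqRel_of_narrowMu_cubicField` consumes (a) `μ₂ = 0` and (b) a UNIFORM bound `D` on the narrow
`2`-defect `ord₂ h⁺ − ord₂ h` along every cyclotomic `ℤ₂`-tower of `ℚ(β)` (Kida-lite to `ℚ(β, √−1)`).  Cell bsd-2adic's narrow Fukuda certificate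
(`NarrowFukuda.narrowMu_of_narrowRankCertificate`) produces (a)+(b) from `rank₂ Cl⁺(F_{n₀+1}) = rank₂ Cl⁺(F_{n₀})`, which is IMPOSSIBLE at `n₀ = 0` as soon as
two primes ramify in `F(√2)` (`NarrowRankJumpLayerOne`: the narrow rank jumps `0 → t − 1`).  This seat's narrow jump door
(`NarrowClassGroupPRankStableOfRankJumpLt`) replaces the equality by ONE INEQUALITY one layer up: `[Cl⁺(F_{n₀+2}) : (Cl⁺)²] ≤ 2·[Cl⁺(F_{n₀+1}) : (Cl⁺)²]`
(narrow `2`-rank jump ≤ 1 between `F(√2)` and `F·ℚ(ζ₁₆)⁺` when `n₀ = 0`), plus a bound `B` on the narrow `2`-ranks of the layers `≤ n₀ + 2` (which is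
then the uniform defect bound).  Here it is wired into `MC₂(W)`:

* `mazurMainConjecture_two_of_muIneqRel_of_narrowJumpCertificate_cubicField` — general Fukuda index `n₀` (part of the certificate);
* `mazurMainConjecture_two_of_muIneqRel_of_not_dvd_discr_of_narrowJump_cubicField` — `n₀ = 0` discharged by `2 ∤ d_{ℚ(β)}` (tree
  `totallyRamifiedFrom_zero_of_not_dvd_discr`; the cell's row files compute `d_{ℚ(β)}`): the data are the narrow `2`-ranks of `ℚ(β)`, `ℚ(β,√2)`,
  `ℚ(β)·ℚ(ζ₁₆)⁺` with ONE inequality between the last two.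

References: [Fukuda1994] Thm. 1 (2), p. 264; [Kida1982JFields] (narrow μ; shape); [GreenbergLNM1716] §5 p. 122, Thm. 4.1; [Kato2004Asterisque] Thm. 17.4;
[Iwasawa1973MuInvariants] Thm. 2–3; tree: `…CubicCarrierRoad` §3, `IwasawaTheory.NarrowClassGroupPRankStableOfRankJumpLt`, `IwasawaTheory.NarrowFukudaRankProofs`.
-/

-- the Theorems namespace of this sub repeats the summit name by design (D-0017 nested layout)
set_option linter.dupNamespace false
set_option autoImplicit false

noncomputable section

open scoped Classical NumberField nonZeroDivisors

namespace Summit.BirchSwinnertonDyer.BirchSwinnertonDyer.Theorems.AlignedTransportAtTwoCubicTowerNarrowJumpDoor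

open NumberField IsDedekindDomain
open Literature.NumberTheory.NumberFields Literature.NumberTheory.GaloisRepresentations Literature.NumberTheory.IwasawaTheory
  Literature.NumberTheory.EllipticCurves
  Summit.BirchSwinnertonDyer.BirchSwinnertonDyer.Theorems.AddKatoTwo

open CongruenceSubgroup WeierstrassCurve Polynomial IntermediateField
  Literature.NumberTheory.EllipticCurves.ModularForms
  Literature.NumberTheory.EllipticCurves.Rank1Residual
  Literature.NumberTheory.EllipticCurves.Greenberg1999
  Literature.NumberTheory.EllipticCurves.Module
  Summit.BirchSwinnertonDyer.Rank1Residual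
  Summit.BirchSwinnertonDyer.Rank1Residual.X1.MuLambda
  Summit.BirchSwinnertonDyer.Rank1Residual.X5
  Summit.BirchSwinnertonDyer.Rank1Residual.F1Sign2
  Summit.BirchSwinnertonDyer.BirchSwinnertonDyer.Theorems.Rank1ResidualX1Defs
  Summit.BirchSwinnertonDyer.BirchSwinnertonDyer.Theses.AlignedTransportAtTwo
  Summit.BirchSwinnertonDyer.BirchSwinnertonDyer.Theorems.AlignedTransportAtTwoCubicCarrierRoad

variable (W : WeierstrassCurve ℚ) [W.IsElliptic] [W.IsGloballyMinimal]

/-- ★★ **THE NARROW JUMP DOOR INTO `MC₂(W)`, BOTH SIGNS of `Δ_W`.**  PRINT⁵ {Kato 17.4 (1)(2) at `2` (`h17`), Greenberg 4.1 (`hGr`), period unit (`hper`),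
modularity (`hmod`), GZK (`hGZK`)} + MuIneqʳ (`hI`, VERBATIM) + the cell hypotheses (good ordinary at `2`, no rational `2`-torsion abscissa, `r_an = 0`,
even-branch `μ(L₂) = 0`, `BSD₂(W)`) + `β` a root of the `2`-division cubic + a NARROW JUMP CERTIFICATE of `ℚ(β)`: an index `n₀` and a bound `B` such that
every cyclotomic `ℤ₂`-extension `κP` of `ℚ(β)` has Fukuda index `n₀`, `[Cl⁺(ℚ(β)_{n₀+2}) : (Cl⁺)²] ≤ 2·[Cl⁺(ℚ(β)_{n₀+1}) : (Cl⁺)²]`, and narrow `2`-ranks `≤ B`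
at the layers `≤ n₀ + 2` ⟹ `MC₂(W)`.  (Narrow jump door ⟹ `μ₂ = 0` and narrow defect `≤ B` uniformly ⟹ att-p5 g24's
`mazurMainConjecture_two_of_muIneqRel_of_narrowMu_cubicField`.) [cite: Fukuda1994, Thm. 1 (2), p. 264] [cite: Kida1982JFields, main theorem (μ-part; shape only)]
[cite: Kato2004Asterisque, Thm. 17.4 (1)(2) (p. 273)] [cite: GreenbergLNM1716, Thm. 4.1 (p. 102) and Conj. 1.11 (p. 58)] [cite: Iwasawa1973MuInvariants, Thm. 2 and Thm. 3, §4] -/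
theorem mazurMainConjecture_two_of_muIneqRel_of_narrowJumpCertificate_cubicField
    (h17 : ∀ [NeZero (W.conductorNorm ℤ)] (f : CuspForm (Gamma0 (W.conductorNorm ℤ)) 2),
      kato_divisibility_allPrimes W 2 (f := f))
    (hGr : Greenberg1999.thm41_charValue_rankZero_anyPrime)
    (hper : realPeriodRat_eq_unit_mul_plusPeriod_two) (hmod : nonempty_modularParametrizationData)
    (hGZK : rank_eq_analyticRank_of_analyticRank_le_one)
    (hI : ∀ (W : WeierstrassCurve ℚ) [W.IsElliptic] [W.IsGloballyMinimal], IsOrdinaryAt W 2 →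
      (∀ x : ℚ, ¬ HasRationalTwoTorsionX W x) →
      ∀ (κ : ZpExtension ℚ 2) (γ : Field.absoluteGaloisGroup ℚ), κ.IsCyclotomic →
      κ.IsTopGenerator γ → IsCyclotomicVariable 2 γ →
      ∀ ⦃N : ℕ⦄ [NeZero N] (f : CuspForm (Gamma0 N) 2), IsNewformOf W f →
      ∀ Gp : IwasawaAlgebra 2, iwasawaToPowerSeries 2 Gp = padicLFunction f (unitRoot W 2 : ℚ_[2]) →
      ∀ (D : W.SelmerDualData κ γ) (Yr : W.FineSelmerDualDataRelaxedInf κ γ),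
        lengthAt (IwasawaAlgebra 2) D.X ⟨IwasawaAlgebra.augIdealP 2, IwasawaAlgebra.isPrime_augIdealP_holds 2⟩ ≤
          lengthAt (IwasawaAlgebra 2) (IwasawaAlgebra 2 ⧸ Ideal.span {Gp})
              ⟨IwasawaAlgebra.augIdealP 2, IwasawaAlgebra.isPrime_augIdealP_holds 2⟩ +
            lengthAt (IwasawaAlgebra 2) Yr.X ⟨IwasawaAlgebra.augIdealP 2, IwasawaAlgebra.isPrime_augIdealP_holds 2⟩)
    (hord : IsOrdinaryAt W 2) (ht : ∀ x : ℚ, ¬ HasRationalTwoTorsionX W x) (hr : W.analyticRank = 0)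
    (hμan : ∀ ⦃N : ℕ⦄ [NeZero N] (f : CuspForm (Gamma0 N) 2), IsNewformOf W f →
      ∀ G : IwasawaAlgebra 2, IsEvenBranchLiftAtTwo W f G → red G ≠ 0)
    (hbsd : BSDp W 2)
    {β : AlgebraicClosure ℚ} (hβ : aeval β W.twoTorsionPolynomial.toPoly = 0) (n₀ B : ℕ)
    (hcert : ∀ κP : ZpExtension ↥(IntermediateField.adjoin ℚ ({β} : Set (AlgebraicClosure ℚ))) 2, κP.IsCyclotomic →
      TotallyRamifiedFrom κP n₀ ∧
      (∀ [NumberField ↥(κP.layer (n₀ + 1))] [NumberField ↥(κP.layer (n₀ + 2))],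
        (powMonoidHom (α := NarrowClassGroup ↥(κP.layer (n₀ + 2))) 2).range.index ≤
          2 * (powMonoidHom (α := NarrowClassGroup ↥(κP.layer (n₀ + 1))) 2).range.index) ∧
      (∀ m : ℕ, m ≤ n₀ + 2 → ∀ [NumberField ↥(κP.layer m)],
        padicValNat 2 (powMonoidHom (α := NarrowClassGroup ↥(κP.layer m)) 2).range.index ≤ B)) :
    MazurMainConjecture W 2 := by
  have hβint : IsIntegral ℚ β := ((AlgebraicClosure.isAlgebraic ℚ).isAlgebraic β).isIntegral
  haveI : FiniteDimensional ℚ ↥(IntermediateField.adjoin ℚ ({β} : Set (AlgebraicClosure ℚ))) :=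
    IntermediateField.adjoin.finiteDimensional hβint
  haveI : NumberField ↥(IntermediateField.adjoin ℚ ({β} : Set (AlgebraicClosure ℚ))) := NumberField.mk
  obtain ⟨hμ, hδ⟩ := NarrowFukuda.narrowMu_of_narrowJumpCertificate _ n₀ B hcert
  exact mazurMainConjecture_two_of_muIneqRel_of_narrowMu_cubicField W h17 hGr hper hmod hGZK hI hord ht hr hμan hbsd hβ hμ B hδ

/-- ★★ **THE NARROW JUMP DOOR, `n₀ = 0` by `2 ∤ d_{ℚ(β)}`** (both signs of `Δ_W`): as above, with Fukuda's index discharged by an odd discriminant of the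
cubic field (tree `totallyRamifiedFrom_zero_of_not_dvd_discr`; `[ℚ(β):ℚ] = 3` is odd since `W[2]` is irreducible).  The certificate is: for every cyclotomic
`κP` of `ℚ(β)`, **`[Cl⁺(ℚ(β)_2) : (Cl⁺)²] ≤ 2·[Cl⁺(ℚ(β)_1) : (Cl⁺)²]`** and narrow `2`-ranks `≤ B` at the layers `0, 1, 2` — the narrow class groups of
`ℚ(β)`, `ℚ(β, √2)`, `ℚ(β)·ℚ(ζ₁₆)⁺`. [cite: Fukuda1994, Thm. 1 (2), p. 264] [cite: Washington1997, §13.1 Lemma 13.3] [cite: Kida1982JFields, main theorem (μ-part; shape only)]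
[cite: Kato2004Asterisque, Thm. 17.4 (1)(2) (p. 273)] [cite: GreenbergLNM1716, Thm. 4.1 (p. 102) and Conj. 1.11 (p. 58)] -/
theorem mazurMainConjecture_two_of_muIneqRel_of_not_dvd_discr_of_narrowJump_cubicField
    (h17 : ∀ [NeZero (W.conductorNorm ℤ)] (f : CuspForm (Gamma0 (W.conductorNorm ℤ)) 2),
      kato_divisibility_allPrimes W 2 (f := f))
    (hGr : Greenberg1999.thm41_charValue_rankZero_anyPrime)
    (hper : realPeriodRat_eq_unit_mul_plusPeriod_two) (hmod : nonempty_modularParametrizationData)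
    (hGZK : rank_eq_analyticRank_of_analyticRank_le_one)
    (hI : ∀ (W : WeierstrassCurve ℚ) [W.IsElliptic] [W.IsGloballyMinimal], IsOrdinaryAt W 2 →
      (∀ x : ℚ, ¬ HasRationalTwoTorsionX W x) →
      ∀ (κ : ZpExtension ℚ 2) (γ : Field.absoluteGaloisGroup ℚ), κ.IsCyclotomic →
      κ.IsTopGenerator γ → IsCyclotomicVariable 2 γ →
      ∀ ⦃N : ℕ⦄ [NeZero N] (f : CuspForm (Gamma0 N) 2), IsNewformOf W f →
      ∀ Gp : IwasawaAlgebra 2, iwasawaToPowerSeries 2 Gp = padicLFunction f (unitRoot W 2 : ℚ_[2]) →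
      ∀ (D : W.SelmerDualData κ γ) (Yr : W.FineSelmerDualDataRelaxedInf κ γ),
        lengthAt (IwasawaAlgebra 2) D.X ⟨IwasawaAlgebra.augIdealP 2, IwasawaAlgebra.isPrime_augIdealP_holds 2⟩ ≤
          lengthAt (IwasawaAlgebra 2) (IwasawaAlgebra 2 ⧸ Ideal.span {Gp})
              ⟨IwasawaAlgebra.augIdealP 2, IwasawaAlgebra.isPrime_augIdealP_holds 2⟩ +
            lengthAt (IwasawaAlgebra 2) Yr.X ⟨IwasawaAlgebra.augIdealP 2, IwasawaAlgebra.isPrime_augIdealP_holds 2⟩)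
    (hord : IsOrdinaryAt W 2) (ht : ∀ x : ℚ, ¬ HasRationalTwoTorsionX W x) (hr : W.analyticRank = 0)
    (hμan : ∀ ⦃N : ℕ⦄ [NeZero N] (f : CuspForm (Gamma0 N) 2), IsNewformOf W f →
      ∀ G : IwasawaAlgebra 2, IsEvenBranchLiftAtTwo W f G → red G ≠ 0)
    (hbsd : BSDp W 2)
    {β : AlgebraicClosure ℚ} (hβ : aeval β W.twoTorsionPolynomial.toPoly = 0)
    (hd : haveI : FiniteDimensional ℚ ↥(IntermediateField.adjoin ℚ ({β} : Set (AlgebraicClosure ℚ))) :=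
        IntermediateField.adjoin.finiteDimensional ((AlgebraicClosure.isAlgebraic ℚ).isAlgebraic β).isIntegral
      haveI : NumberField ↥(IntermediateField.adjoin ℚ ({β} : Set (AlgebraicClosure ℚ))) := NumberField.mk
      ¬ (2 : ℤ) ∣ NumberField.discr ↥(IntermediateField.adjoin ℚ ({β} : Set (AlgebraicClosure ℚ)))) (B : ℕ)
    (hcert : ∀ κP : ZpExtension ↥(IntermediateField.adjoin ℚ ({β} : Set (AlgebraicClosure ℚ))) 2, κP.IsCyclotomic →
      (∀ [NumberField ↥(κP.layer 1)] [NumberField ↥(κP.layer 2)],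
        (powMonoidHom (α := NarrowClassGroup ↥(κP.layer 2)) 2).range.index ≤
          2 * (powMonoidHom (α := NarrowClassGroup ↥(κP.layer 1)) 2).range.index) ∧
      (∀ m : ℕ, m ≤ 2 → ∀ [NumberField ↥(κP.layer m)],
        padicValNat 2 (powMonoidHom (α := NarrowClassGroup ↥(κP.layer m)) 2).range.index ≤ B)) :
    MazurMainConjecture W 2 := by
  have hirr := AlignedTransportAtTwoSeed.irr_two_of_forall_not_hasRationalTwoTorsionX W ht
  have hβint : IsIntegral ℚ β := ((AlgebraicClosure.isAlgebraic ℚ).isAlgebraic β).isIntegral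
  haveI : FiniteDimensional ℚ ↥(IntermediateField.adjoin ℚ ({β} : Set (AlgebraicClosure ℚ))) :=
    IntermediateField.adjoin.finiteDimensional hβint
  haveI : NumberField ↥(IntermediateField.adjoin ℚ ({β} : Set (AlgebraicClosure ℚ))) := NumberField.mk
  have h3 : Module.finrank ℚ ↥(IntermediateField.adjoin ℚ ({β} : Set (AlgebraicClosure ℚ))) = 3 :=
    AddKatoTwo.finrank_adjoin_root_twoTorsionPolynomial_eq_three W hirr hβ
  have hodd : ¬ 2 ∣ Module.finrank ℚ ↥(IntermediateField.adjoin ℚ ({β} : Set (AlgebraicClosure ℚ))) := by rw [h3]; norm_num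
  exact mazurMainConjecture_two_of_muIneqRel_of_narrowJumpCertificate_cubicField W h17 hGr hper hmod hGZK hI hord ht hr hμan hbsd hβ
    0 B fun κP hκP => ⟨totallyRamifiedFrom_zero_of_not_dvd_discr hodd hd κP hκP, (hcert κP hκP).1, (hcert κP hκP).2⟩

end Summit.BirchSwinnertonDyer.BirchSwinnertonDyer.Theorems.AlignedTransportAtTwoCubicTowerNarrowJumpDoor

end
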